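import Summits.PneNP.PneNP.Theses.SymmetryBudget

/-!
# drefute gen 2 — `stub_cutspan` needs SOME lower bound on `m`: the corner `m = 0`

Mutation evidence for the line `kotzig-cutspan` (skeleton sha f8f528923483), crux stmt-PneNP-10637.
The definitions below (§1, §2, §3, §4 of `Lines/kotzig-cutspan.lean`) are vendored VERBATIM (the
skeleton module has no olean, so it cannot be imported); only the namespace differs.

Finding (corrects the gen-1 note "hm is not load-bearing … trivially at m ≤ 1 both sides false"):
at `m = 0` the left side `KotzigPred (Gr 0 x) (freeSet 0)` is TRUE (the empty families cover `∅` and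
`∅ᶜ = ∅`, all slot counts are `0`, connectivity is vacuous) while `Residue₀ 0 x` is FALSE (`vA` needs
`(dsupp d).Nonempty`, impossible over `Fin (gOf 0) = Fin 0`). So `stub_cutspan` with `hm : 4 ≤ m`
replaced by nothing is false (`stub_cutspan_false_without_hm`); `1 ≤ m` is the weakest repair
(m = 1: both sides false; m = 2, 3: gen-1 brute force, both sides agree). Information for the prover:
inside `stub_cutspan` no case split on `m ≥ 4` is needed, but the statement is NOT true at `m = 0`.
-/

set_option linter.dupNamespace false

noncomputable section

namespace Summit.PneNP.PneNP.Cruxes.HamCompiles.KotzigCutspan.DrefuteG2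

open Finset

/-! ### §1 (verbatim) -/

section Kotzig

variable {V : Type*}

abbrev VSeq (V : Type*) := V × List V

def VSeq.verts (p : VSeq V) : List V := p.1 :: p.2

def VSeq.first (p : VSeq V) : V := p.1

def VSeq.last (p : VSeq V) : V := (p.1 :: p.2).getLast (List.cons_ne_nil _ _)

variable [DecidableEq V]

def IsCoverOf (G : SimpleGraph V) (S : Finset V) (P : List (VSeq V)) : Prop :=
  (P.map VSeq.verts).flatten.Nodup ∧ (P.map VSeq.verts).flatten.toFinset = S ∧
    ∀ p ∈ P, List.IsChain G.Adj p.verts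

def nbA [Fintype V] (G : SimpleGraph V) [DecidableRel G.Adj] (F : Finset V) (u : V) : Finset V :=
  Fᶜ.filter fun a => G.Adj u a

def fSlots {L : Type*} [DecidableEq L] (lab : V → L) (PF : List (VSeq V)) (i : L) : ℕ :=
  PF.countP (fun p => decide (lab p.first = i)) + PF.countP (fun p => decide (lab p.last = i))

def aSlots {L : Type*} [DecidableEq L] (PA : List (VSeq V × (L × L))) (i : L) : ℕ :=
  PA.countP (fun q => decide (q.2.1 = i)) + PA.countP (fun q => decide (q.2.2 = i))

def junctionGraph {L : Type*} (lab : V → L) (PF : List (VSeq V)) (PA : List (VSeq V × (L × L))) :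
    SimpleGraph L :=
  SimpleGraph.fromRel fun i j =>
    (∃ p ∈ PF, lab p.first = i ∧ lab p.last = j) ∨ (∃ q ∈ PA, q.2.1 = i ∧ q.2.2 = j)

def KotzigPred [Fintype V] (G : SimpleGraph V) [DecidableRel G.Adj] (F : Finset V) : Prop :=
  ∃ (PF : List (VSeq V)) (PA : List (VSeq V × (Finset V × Finset V))),
    IsCoverOf G F PF ∧ IsCoverOf G Fᶜ (PA.map Prod.fst) ∧
    (∀ q ∈ PA, q.1.first ∈ q.2.1 ∧ q.1.last ∈ q.2.2) ∧
    (∀ i, fSlots (nbA G F) PF i = aSlots PA i) ∧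
    (∀ i j, 0 < fSlots (nbA G F) PF i → 0 < fSlots (nbA G F) PF j →
      (junctionGraph (nbA G F) PF PA).Reachable i j)

end Kotzig

/-! ### §2 (verbatim) -/

def gOf (m : ℕ) : ℕ := Nat.log 2 m

def IsAnch (m : ℕ) (v : Fin m) : Prop := (v : ℕ) + gOf m < m

instance (m : ℕ) (v : Fin m) : Decidable (IsAnch m v) := by unfold IsAnch; infer_instance

def freeSet (m : ℕ) : Finset (Fin m) := univ.filter fun v => ¬ IsAnch m v

def Gr (m : ℕ) (x : Fin m × Fin m → Bool) : SimpleGraph (Fin m) :=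
  SimpleGraph.fromRel fun u v => x (u, v) = true

instance (m : ℕ) (x : Fin m × Fin m → Bool) : DecidableRel (Gr m x).Adj := by
  unfold Gr; infer_instance

section Window

variable (m : ℕ) (x : Fin m × Fin m → Bool)

def cls (u : Fin m) : Finset (Fin m) := nbA (Gr m x) (freeSet m) u

def classes : Finset (Finset (Fin m)) := (freeSet m).image (cls m x)

def key (N : Finset (Fin m)) : ℕ := ∑ a ∈ N, 2 ^ (a : ℕ)

def rankOf (N : Finset (Fin m)) : ℕ := ((classes m x).filter fun N' => key m N' < key m N).card

def rk (u : Fin m) : ℕ := rankOf m x (cls m x u)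

end Window

/-! ### §3 (verbatim, the parts `Residue₀` needs) -/

section FSide

variable {g : ℕ}

def dsupp (d : Fin g → ℕ) : Finset (Fin g) := univ.filter fun i => 0 < d i

def Adm (d : Fin g → ℕ) (S : Fin g → Bool) : Prop :=
  (∀ i, S i = true → 0 < d i) ∧ ∃ h : (dsupp d).Nonempty, S ((dsupp d).min' h) = true

def consF {V : Type*} (lab : V → ℕ) (PF : List (VSeq V)) (S : Fin g → Bool) : Prop :=
  ∀ p ∈ PF, (∃ i : Fin g, S i = true ∧ (i : ℕ) = lab p.first) ↔
    (∃ i : Fin g, S i = true ∧ (i : ℕ) = lab p.last)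

def consA {V : Type*} (PA : List (VSeq V × (Fin g × Fin g))) (S : Fin g → Bool) : Prop :=
  ∀ q ∈ PA, (S q.2.1 = true ↔ S q.2.2 = true)

open scoped Classical in
def uF {V : Type*} (lab : V → ℕ) (PF : List (VSeq V)) : (Fin g → Bool) → ZMod 2 :=
  fun S => if consF lab PF S then 1 else 0

open scoped Classical in
def vA {V : Type*} (d : Fin g → ℕ) (PA : List (VSeq V × (Fin g × Fin g))) :
    (Fin g → Bool) → ZMod 2 :=
  fun S => if Adm d S ∧ consA PA S then 1 else 0

abbrev Vec (g : ℕ) : Type := (Fin g → Bool) → ZMod 2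

end FSide

section FData

variable (m : ℕ) (x : Fin m × Fin m → Bool)

def WF (d : Fin (gOf m) → ℕ) : Submodule (ZMod 2) (Vec (gOf m)) :=
  Submodule.span (ZMod 2)
    {v | ∃ PF : List (VSeq (Fin m)), IsCoverOf (Gr m x) (freeSet m) PF ∧
      (∀ i : Fin (gOf m), fSlots (rk m x) PF (i : ℕ) = d i) ∧ v = uF (rk m x) PF}

end FData

/-! ### §4 (verbatim) -/

section AData

variable (m : ℕ)

abbrev AIdx (m : ℕ) : Type := (Fin m × Fin m) ⊕ (Fin (gOf m) × Fin m)

open scoped Classical in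
def aData (x : Fin m × Fin m → Bool) : AIdx m → Bool
  | Sum.inl (a, a') => decide (IsAnch m a ∧ IsAnch m a' ∧ x (a, a') = true)
  | Sum.inr (i, a) => decide (∃ u ∈ freeSet m, rk m x u = (i : ℕ) ∧ a ∈ cls m x u)

def ACover (ab : AIdx m → Bool) (d : Fin (gOf m) → ℕ)
    (PA : List (VSeq (Fin m) × (Fin (gOf m) × Fin (gOf m)))) : Prop :=
  IsCoverOf (SimpleGraph.fromRel fun u v : Fin m => ab (Sum.inl (u, v)) = true) (freeSet m)ᶜ
      (PA.map Prod.fst) ∧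
    (∀ q ∈ PA, ab (Sum.inr (q.2.1, q.1.first)) = true ∧ ab (Sum.inr (q.2.2, q.1.last)) = true) ∧
    (∀ i, aSlots PA i = d i)

def Residue₀ (x : Fin m × Fin m → Bool) : Prop :=
  ∃ d : Fin (gOf m) → ℕ, (∑ t, d t) ≤ 2 * gOf m ∧
    ∃ PA : List (VSeq (Fin m) × (Fin (gOf m) × Fin (gOf m))), ACover m (aData m x) d PA ∧
      ∃ w ∈ WF m x d, ∑ S : Fin (gOf m) → Bool, w S * vA d PA S = 1

end AData

/-! ### The corner `m = 0` -/

/-- At `m = 0` the Kotzig interface predicate holds (empty families). -/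
theorem kotzigPred_zero (x : Fin 0 × Fin 0 → Bool) : KotzigPred (Gr 0 x) (freeSet 0) := by
  refine ⟨[], [], ⟨List.nodup_nil, ?_, fun p hp => ?_⟩, ⟨List.nodup_nil, ?_, fun p hp => ?_⟩,
    fun q hq => ?_, fun i => rfl, fun i j hi => ?_⟩
  · ext v; exact v.elim0
  · simp at hp
  · ext v; exact v.elim0
  · simp at hp
  · simp at hq
  · simp [fSlots] at hi

/-- `gOf 0 = 0`. -/
theorem gOf_zero : gOf 0 = 0 := Nat.log_zero_right 2

/-- At `m = 0` the graph-level residual predicate fails: `vA` vanishes identically because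
`dsupp d ⊆ Fin (gOf 0) = Fin 0` is empty. -/
theorem not_residue₀_zero (x : Fin 0 × Fin 0 → Bool) : ¬ Residue₀ 0 x := by
  rintro ⟨d, -, PA, -, w, -, hsum⟩
  have hvA : ∀ S, vA d PA S = 0 := by
    intro S
    unfold vA
    rw [if_neg]
    rintro ⟨⟨-, ⟨i, -⟩, -⟩, -⟩
    exact (Fin.cast gOf_zero i).elim0
  simp [hvA] at hsum

/-- **Mutation: `stub_cutspan` without any lower bound on `m` is false** (witness `m = 0`). -/
theorem stub_cutspan_false_without_hm :
    ¬ ∀ (m : ℕ) (x : Fin m × Fin m → Bool), (KotzigPred (Gr m x) (freeSet m) ↔ Residue₀ m x) :=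
  fun h => not_residue₀_zero (fun _ => false) ((h 0 _).1 (kotzigPred_zero _))

end Summit.PneNP.PneNP.Cruxes.HamCompiles.KotzigCutspan.DrefuteG2
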